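import Literature.IUT.HodgeTheaters.Labels
import Literature.IUT.HodgeTheaters.GlobalRealifiedFrobenioids
import Literature.IUT.HodgeArakelov.GlobalGaussianFrobenioids

/-!
# [IUTchII] Cor 4.5 (v) / 4.6 (v): the global realified Gaussian Frobenioid of the initial Θ-data at
# divisor level (bridge over [IUTchI] Ex 3.5)

Merge bridge (abc-iut cell, layer L6 → L5; no re-typing). `GlobalGaussianFrobenioids.lean` (p404130)
typed the "vector of ratios" `(…, j²·, …)` of [IUTchII] Cor 4.5 (v) p. 134 / Remark 4.5.4 p. 136 REAL over
an ABSTRACT additive divisor monoid `Φ` (`weightedDiagonal`, `globalEvalIso`, `weightedDiagonalHom_local`).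
The [IUTchI] Example 3.5 divisor monoids of the initial Θ-data are now in the tree
(`Literature.IUT.HodgeTheaters.InitialThetaData.PhiMod` = `Φ_{C⊩_mod}`, `.PhiTht` = `Φ_{C⊩_tht} =
Φ_{C⊩_mod}·log(Θ)`, `.modToTht`, `.rho` = the local comparison `ρ_w`). This file instantiates:

* `phiGau D` — `Φ_{C⊩_gau} ⊆ ∏_{j ∈ F_l^⋇} Φ_{C⊩_mod,j}`, the weighted diagonal for `l⋇ = (l−1)/2` of the
  initial Θ-data ([IUTchII] Cor 4.5 (v), Cor 4.6 (v) p. 139, Cor 4.10 (ii));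
* `thtToGau D : Φ_{C⊩_tht} ⥲ Φ_{C⊩_gau}` — the global formal evaluation isomorphism
  (`l⋇ ≥ 1` from `5 ≤ l`, Def 3.1 (c));
* `rho_thtToGau` — compatibility with the local comparison maps `ρ_w` of Ex 3.5 (i): the `j`-th
  component has local value `j² · ρ_w(φ_v)`, i.e. the `j²·log(p_v)`-ray of Prop 4.1 (iv) / 4.3 (iv)
  ("compatible … with the local evaluation isomorphisms of (iv)", Cor 4.5 (v) p. 134).

S. Mochizuki, *Inter-universal Teichmüller theory II*, kurims Dec-2020 manuscript, Cor 4.5 (v) pp. 133–134,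
Rmk 4.5.4 p. 136, Cor 4.6 (v) p. 139; *I*, kurims May-2020 manuscript, Ex 3.5 pp. 84–86. Claim key
`Mochizuki2012` DISPUTED (D-0012): definitions / bookkeeping only; nothing here asserts a disputed claim.
-/

namespace Literature.IUT.HodgeArakelov

open Literature.IUT.HodgeTheaters
open scoped NNReal

universe u v w

section Cor45v

variable {F : Type u} {K : Type v} {Fbar : Type w} [Field F] [NumberField F] [Field K]
  [NumberField K] [Algebra F K] [Field Fbar] [Algebra F Fbar] [Algebra K Fbar]
  {E : WeierstrassCurve F} [E.IsElliptic] {l : ℕ} {P : BadPlacePredicates K}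

/-- `l⋇ ≥ 1` for the prime `l ≥ 5` of initial Θ-data ([IUTchI] Def 3.1 (c); §0 `l⋇ = (l−1)/2`).
[cite: Mochizuki2012, Def 3.1 (c) p.61] -/
theorem lStar_pos_of_initialThetaData (D : InitialThetaData F K Fbar E l P) : 0 < lStar l :=
  lt_of_lt_of_le two_pos (two_le_lStar D.five_le_l)

/-- **[IUTchII] Cor 4.5 (v) p. 134 / Cor 4.6 (v) p. 139 over [IUTchI] Ex 3.5**: the divisor monoid of the
global realified Gaussian Frobenioid `C^⊩_gau ⊆ ∏_{j ∈ F_l^⋇} C^⊩_{mod,j}` — "the image of … `(…, j²·, …)`"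
(Remark 4.5.4 p. 136: "elements of the form `(1²·φ, 2²·φ, …, j²·φ, …)`") — for the divisor monoid
`Φ_{C⊩_mod}` of the initial Θ-data (`InitialThetaData.PhiMod`, Ex 3.5 (i)). [cite: Mochizuki2012, Cor 4.5 (v) p.134] -/
noncomputable def phiGau (D : InitialThetaData F K Fbar E l P) : AddSubmonoid (Fin (lStar l) → D.PhiMod) :=
  weightedDiagonal D.PhiMod (lStar l)

/-- **The global formal evaluation isomorphism `C^⊩_tht ⥲ C^⊩_gau` at divisor level** ([IUTchII] Cor 4.5 (v)
p. 134 "`D^⊩_env ⥲ D^⊩_gau`"; Cor 4.6 (v) p. 139 "`C^⊩_env(†HT^Θ) ⥲ … ⥲ C^⊩_gau(†HT^Θ)`"; Cor 4.10 (ii)):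
`Φ_{C⊩_tht} = Φ_{C⊩_mod}·log(Θ) ⥲ Φ_{C⊩_mod} ⥲ weightedDiagonal`, `log(Θ)·φ ↦ (1²·φ, …, (l⋇)²·φ)`, for the
initial Θ-data (`l⋇ ≥ 1`). [cite: Mochizuki2012, Cor 4.5 (v) p.134] -/
noncomputable def thtToGau (D : InitialThetaData F K Fbar E l P) : D.PhiTht ≃+ phiGau D :=
  D.modToTht.symm.trans (globalEvalIso D.PhiMod (lStar l) (lStar_pos_of_initialThetaData D))

/-- The `j`-th component of the evaluation isomorphism is `j² ·` the divisor (`j = i + 1`).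
[cite: Mochizuki2012, Rmk 4.5.4 p.136] -/
theorem thtToGau_apply (D : InitialThetaData F K Fbar E l P) (φ : D.PhiTht) (i : Fin (lStar l)) :
    ((thtToGau D φ : phiGau D) : Fin (lStar l) → D.PhiMod) i = sqWeight (lStar l) i • D.modToTht.symm φ :=
  rfl

/-- **Compatibility with the local evaluation isomorphisms** ([IUTchII] Cor 4.5 (v) p. 134: "compatible,
relative to the bijections `Prime(−) ⥲ V` and local isomorphisms …, with the local evaluation
isomorphisms of (iv)"): reading the `v_mod`-component below a place `w ∈ V(K)` through Ex 3.5 (i)'s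
`ρ_w : Φ_{C⊩_mod,v} ⥲ Φ^rlf_{C⊢_w}` (`InitialThetaData.rho`), the `j`-th component of the image of `φ`
has local value `j² · ρ_w(φ_v)` — the `j²·log(p_v)`-ray of Prop 4.1 (iv) / 4.3 (iv).
[cite: Mochizuki2012, Cor 4.5 (v) p.134] -/
theorem rho_thtToGau (D : InitialThetaData F K Fbar E l P) (φ : D.PhiTht) (i : Fin (lStar l))
    (w : Val K) :
    D.rho w (((thtToGau D φ : phiGau D) : Fin (lStar l) → D.PhiMod) i
        (Val.restrict (fieldOfModuli E) (Val.restrict F w))) =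
      ((i.val + 1) ^ 2 : ℕ) *
        D.rho w (D.modToTht.symm φ (Val.restrict (fieldOfModuli E) (Val.restrict F w))) := by
  rw [thtToGau_apply, Finsupp.smul_apply, map_nsmul, nsmul_eq_mul, sqWeight]

end Cor45v

end Literature.IUT.HodgeArakelov
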